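import Summits.KontsevichZagierPeriods.KontsevichZagierPeriods.Theorems.HermiteRigidityIslandComplementMultiLevelLine

/-!
# `ReductionRigidity` (stmt-KontsevichZagierPeriods-3407), line `Sketch`, stub `stub_islandComplement`:
# the weight-one island at every RATIONAL level off `[0,1]` (`stub_rationalLevelLineKernel`)

Route `KontsevichZagierPeriods/HermiteRigidity`, crux `ReductionRigidity` (stmt-3407); a further
enlargement of growth deliverable G1 (`stub_multiLevelLineKernel`, integer levels `N ≥ 2`,
`HermiteRigidityIslandComplementMultiLevelLine.lean`) of the stub plan
`Cruxes/ReductionRigidity/STUB-PLAN-stub_islandComplement.md`: Conjecture 1 in kernel form on the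
weight-one line sector at ALL RATIONAL LEVELS `ν ∉ [0,1]` at once,

  `S = {[□¹, x^a/(ν − x)^m] : ν ∈ ℚ, ν > 1 or ν < 0, a, m ∈ ℕ} ∪ {[pt, q] : q ∈ ℚ}`,
  `∀ c ∈ closure S, eval c = 0 → c ∈ KZ.relations`                 (`stub_rationalLevelLineKernel`),

so that every logarithm of a positive rational (`[□¹, 1/(ν − x)] = log(ν/(ν − 1))`) and every
`ℤ`-linear relation among such logarithms and rationals is covered. Same mechanism as G1: every
element of the closure is presented by ONE cube representation `[□¹, p/q]` with `q` a product of the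
split factors `(ν − X)^m`, non-vanishing on `[0,1]` because `ν ∉ [0,1]`, and the landed BoxVanishing
certificate `BoxSplitCertificate.box_split_mem_relations` (via `of_rep_mem_relations_of_split`)
finishes. References: M. Kontsevich, D. Zagier, *Periods* (2001), §1.2
[cite: KontsevichZagier2001, §1.2]. No definitions are introduced.
-/

noncomputable section

open MeasureTheory Set MvPolynomial
open scoped Polynomial

namespace Summit.KontsevichZagierPeriods.HermiteRigidity.ReductionRigidity

open Literature.NumberTheory.Transcendental
open Literature.NumberTheory.Transcendental.KZ

/-- On `[0,1]`, `ν − t ≠ 0` for a rational level `ν > 1` or `ν < 0`. [folklore] -/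
theorem ratLevel_sub_ne_zero {ν : ℚ} (hν : 1 < ν ∨ ν < 0) {t : ℝ} (ht : t ∈ Set.Icc (0:ℝ) 1) :
    (ν : ℝ) - t ≠ 0 := by
  rcases hν with h | h
  · have : (1:ℝ) < (ν:ℝ) := by exact_mod_cast h
    intro h0; linarith [ht.2]
  · have : (ν:ℝ) < 0 := by exact_mod_cast h
    intro h0; linarith [ht.1]

/-- **Generators at a rational level are presented**: `[□¹, x^a/(ν − x)^m] ≡ [□¹, X^a/(C ν − X)^m]`
with `(C ν − X)^m` split over `ℚ` and non-vanishing on `[0,1]` (`ν > 1` or `ν < 0`); the given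
representation is any representation with domain `□¹` and that integrand on it (congruence).
[cite: KontsevichZagier2001, §1.2 rule (1)] -/
theorem presented_lineGen_rat {ν : ℚ} (hν : 1 < ν ∨ ν < 0) (a m : ℕ) (r : IntegralRep 1)
    (hr : r.domain = cube 1)
    (hri : EqOn r.integrand (fun p => p 0 ^ a / ((ν : ℝ) - p 0) ^ m) (cube 1)) :
    ∃ (p q : ℚ[X]) (T : RFun 1), q.Splits ∧
      (∀ t ∈ Set.Icc (0:ℝ) 1, (Polynomial.aeval t q : ℝ) ≠ 0) ∧
      (∀ x ∈ cube 1, T.fn x = (Polynomial.aeval (x 0) p : ℝ) / Polynomial.aeval (x 0) q) ∧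
      KZ.of r - KZ.of T.rep ∈ KZ.relations := by
  have hq01 : ∀ t ∈ Set.Icc (0:ℝ) 1,
      (Polynomial.aeval t ((Polynomial.C ν - Polynomial.X) ^ m) : ℝ) ≠ 0 := by
    intro t ht
    simp only [map_pow, map_sub, Polynomial.aeval_C, Polynomial.aeval_X, eq_ratCast]
    exact pow_ne_zero _ (ratLevel_sub_ne_zero hν ht)
  obtain ⟨T, hT⟩ := exists_rfun_of_polynomial_div (Polynomial.X ^ a)
    ((Polynomial.C ν - Polynomial.X) ^ m) hq01
  refine ⟨Polynomial.X ^ a, (Polynomial.C ν - Polynomial.X) ^ m, T, ?_, hq01, hT, ?_⟩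
  · rw [← neg_sub]
    exact ((Polynomial.Splits.X_sub_C _).neg).pow m
  · refine KZ.of_sub_of_mem_relations_of_eqOn (by rw [hr]; rfl) fun x hx => ?_
    rw [hr] at hx
    rw [hri hx]
    show x 0 ^ a / ((ν : ℝ) - x 0) ^ m = T.fn x
    rw [hT x hx]
    simp only [map_pow, map_sub, Polynomial.aeval_C, Polynomial.aeval_X, eq_ratCast]

/-- **Every element of the rational-level line closure is presented** by one cube representation
`[□¹, p/q]` with `q` split over `ℚ` and non-vanishing on `[0,1]` (closure induction over
`presented_lineGen_rat`, `presented_const`, `presented_closed`). [cite: KontsevichZagier2001, §1.2] -/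
theorem presented_of_mem_closure_rat (c : FormalRep)
    (hc : c ∈ AddSubgroup.closure
      ({c : FormalRep | ∃ (ν : ℚ) (r : IntegralRep 1) (a m : ℕ), (1 < ν ∨ ν < 0) ∧
          r.domain = cube 1 ∧
          EqOn r.integrand (fun p => p 0 ^ a / ((ν : ℝ) - p 0) ^ m) (cube 1) ∧ c = KZ.of r} ∪
       {c | ∃ (r : IntegralRep 0) (q : ℚ), r.domain = cube 0 ∧
          EqOn r.integrand (fun _ => (q : ℝ)) (cube 0) ∧ c = KZ.of r})) :
    ∃ (p q : ℚ[X]) (T : RFun 1), q.Splits ∧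
      (∀ t ∈ Set.Icc (0:ℝ) 1, (Polynomial.aeval t q : ℝ) ≠ 0) ∧
      (∀ x ∈ cube 1, T.fn x = (Polynomial.aeval (x 0) p : ℝ) / Polynomial.aeval (x 0) q) ∧
      c - KZ.of T.rep ∈ KZ.relations := by
  induction hc using AddSubgroup.closure_induction with
  | mem x hx =>
    rcases hx with ⟨ν, r, a, m, hν, hr, hri, rfl⟩ | ⟨r, q₀, hr, hri, rfl⟩
    · exact presented_lineGen_rat hν a m r hr hri
    · exact presented_const q₀ r hr hri
  | zero => exact presented_closed.1
  | add x y _ _ hx hy => exact presented_closed.2.1 x y hx hy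
  | neg x _ hx => exact presented_closed.2.2 x hx

/-! ## The registered sub-goal stub -/

/-- **Stub `stub_rationalLevelLineKernel`** (sub-goal of crux `ReductionRigidity`, stmt-3407, line
`Sketch`, enlargement of G1 for the remainder stub `stub_islandComplement`): **Conjecture 1 in kernel
form on the weight-one box sector at every rational level `ν ∉ [0,1]`**, unconditionally. For every
formal `ℤ`-combination `c` of the representations `[□¹, x^a/(ν − x)^m]` (`ν ∈ ℚ`, `ν > 1` or `ν < 0`,
all at once) and the rational constants `[pt, q]`: if `eval c = 0` then `c ∈ KZ.relations`. Proof: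
`c ≡ [□¹, p/q]` with `q` split (`presented_of_mem_closure_rat`), `[□¹, p/q]` has value `eval c = 0`
by soundness and is a relation by the BoxVanishing certificate (`of_rep_mem_relations_of_split`).
[cite: KontsevichZagier2001, §1.2 Conjecture 1 (this sub-family)] -/
theorem stub_rationalLevelLineKernel :
    ∀ c ∈ AddSubgroup.closure
      ({c : FormalRep | ∃ (ν : ℚ) (r : IntegralRep 1) (a m : ℕ), (1 < ν ∨ ν < 0) ∧
          r.domain = cube 1 ∧
          EqOn r.integrand (fun p => p 0 ^ a / ((ν : ℝ) - p 0) ^ m) (cube 1) ∧ c = KZ.of r} ∪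
       {c | ∃ (r : IntegralRep 0) (q : ℚ), r.domain = cube 0 ∧
          EqOn r.integrand (fun _ => (q : ℝ)) (cube 0) ∧ c = KZ.of r}),
      KZ.eval c = 0 → c ∈ KZ.relations := by
  intro c hc h0
  obtain ⟨p, q, T, hsplit, hq01, hT, hcT⟩ := presented_of_mem_closure_rat c hc
  have hv : KZ.eval (KZ.of T.rep) = 0 := by
    have h := (AddMonoidHom.mem_ker).1 (relations_le_ker_eval_holds hcT)
    rwa [map_sub, h0, zero_sub, neg_eq_zero] at h
  have hT0 : KZ.of T.rep ∈ KZ.relations := of_rep_mem_relations_of_split p q hsplit hq01 T hT hv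
  have : c = (c - KZ.of T.rep) + KZ.of T.rep := by abel
  rw [this]
  exact KZ.relations.add_mem hcT hT0

end Summit.KontsevichZagierPeriods.HermiteRigidity.ReductionRigidity

end
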